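import Summits.NavierStokesRegularity.FluidComputer.PalasekTowerBurgersLayerReadoutFloors
import Literature.NumberTheory.LFunctions.VinogradovKorobovInputsProofs

/-!
# The sheet read-out does not drift: ALL FOUR register readouts of a level read as a Burgers vortex
# LAYER, uniformly in the level and in the rates

Cell `ns-blowup`, seat `ns-blowup-ecbridge-4` (g6; D-0074 GROUP C «BRIDGE SUPPORT», stub `first_episode` of
the crux `EpisodeBase` = item stmt-NavierStokesRegularity-19179 of the route `PalasekTowerBreakdown`, line
`slot`; bears also on the read-out halves of 19249 `HeredityAtOne` / 19250 `HeredityFromTwo` / 19178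
`EpisodeInduction`; supports / evidence only, nothing claimed). The crux idea «orthogonal-seed-contact-strain»
(19179 evidence #47/#48) claims that, read as a Burgers vortex LAYER with jump `ΔU = (12/5)·Y_j` in the
strain `γ = (6/5)·N_j²` at `ν = 1` (rate `κ = (3/5)^{1/2} N_j`), the level-`j` readouts of the rigid
register are met with constants that do NOT drift with `j` — in contrast with the round Burgers vortex
(`palasekTowerBreakdown_burgers_eventually_overshoot`). Its `SheetBandUniform` (PROVED in
`PalasekTowerBurgersLayerReadoutFloors.lean`) is the gradient face only. Here ALL FOUR faces, for every
`R : TowerRates` and every level `j` (namespace `SheetReadout`, `u_j := burgersLayer ((6/5)N_j²) 1 ((12/5)Y_j)`):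

* velocity floor `Y_j ≤ ‖u_j(x⋆)‖` at `x⋆ = ((6/5)/κ, 0, 0)` (so `κ x⋆₀ = 6/5`): from the degree-three
  exponential minorant `1 − x + x²/2 − x³/6 ≤ e^{−x}` (`x ≥ 0`; in the tree as
  `Literature.NumberTheory.LFunctions.ZetaRealLeRamare.cubic_le_exp_neg`) integrated to
  `∫₀^b e^{−t²} dt ≥ b − b³/3 + b⁵/10 − b⁷/42`, `= 0.78751…` at `b = 6/5`, whence
  `V(x⋆₀) ≥ (12/5)·0.7875/1.775 · Y_j ≥ 1.06 Y_j`;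
* strain floor `A_j ≤ ‖Du_j(0)‖` (`V′(0) = (12/5)(3/(5π))^{1/2} Y_j N_j ≥ A_j = Y_j N_j`; any rates);
* ceiling `‖u_j(x)‖ ≤ (5/3)Y_j` on the slab `N_j⁴(x₀² + x₂²) ≤ (9/10)Y_j²` (half-width `≈ 0.95·N_j^{−7/10}`
  on the wide rates): `‖u‖² = (36/25)N⁴(x₀²+x₂²) + V² ≤ (36/25)(9/10)Y² + (36/25)Y² ≤ (25/9)Y²`;
* core ledger `N_j^{β−2} ≤ circulation u_j γ_{1/N_j}` on the horizontal circle of radius `1/N_j`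
  (`circulation_circle_ge` with `κρ = (3/5)^{1/2}`: circulation `≥ (48/25)√π (3/5)^{1/2} · Y_j/N_j
  ≥ 2.5 · N_j^{β−2}`, using `Y_j/N_j = N_j^{β−2}`),

and the four facts packaged as the register's clauses on any rigid schedule (`c₁ = 1`, `c₂ = 5/3`): floor
(ball radius `≥ 2/N_j`), strain (radius `≥ 0`), slab ceiling, and the `j`-clause of `CoreLedger`.

LABEL: MODEL-side register arithmetic on exact, steady, infinite-energy profiles. WHAT THIS IS NOT: not
Navier–Stokes evidence — nothing about any registered stage, any host, `HeredityAt j`, `RungG j`,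
`EpisodeBaseG` or blow-up; a read-out profile meeting the faces says nothing about whether a flow reaches it;
the register's ceiling is global in `x` and is met only on the slab where the layer is the local model.
References: J. M. Burgers, Adv. Appl. Mech. 1 (1948) 171–199; S. Palasek, arXiv:2605.13827 §3–§4.
[folklore] calculus and [cite: Palasek2026ElementaryModel, §4] for the register.
-/

noncomputable section

namespace Summit.NavierStokesRegularity.FluidComputer.PalasekTowerClayBridge

open Set MeasureTheory Filter Topology Function Real intervalIntegral
open scoped ContDiff
open Literature.Analysis.FluidPDE

namespace SheetReadout

/-! ## §1 The erf integral at `6/5` from the degree-three exponential minorant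

The minorant `1 − x + x²/2 − x³/6 ≤ e^{−x}` (`x ≥ 0`) is already in the tree
(`Literature.NumberTheory.LFunctions.ZetaRealLeRamare.cubic_le_exp_neg`, imported). -/

/-- The degree-seven erf minorant: `b − b³/3 + b⁵/10 − b⁷/42 ≤ ∫₀^b e^{−t²} dt` for `b ≥ 0`. [folklore] -/
theorem poly_le_integral_exp_neg_sq {b : ℝ} (hb : 0 ≤ b) :
    b - b ^ 3 / 3 + b ^ 5 / 10 - b ^ 7 / 42 ≤ ∫ t in (0 : ℝ)..b, Real.exp (-t ^ 2) := by
  have hF : ∀ t, HasDerivAt (fun t : ℝ => t - t ^ 3 / 3 + t ^ 5 / 10 - t ^ 7 / 42)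
      (1 - t ^ 2 + t ^ 4 / 2 - t ^ 6 / 6) t := by
    intro t
    have h := (((hasDerivAt_id t).sub ((hasDerivAt_pow 3 t).div_const 3)).add
      ((hasDerivAt_pow 5 t).div_const 10)).sub ((hasDerivAt_pow 7 t).div_const 42)
    refine h.congr_deriv ?_
    simp; ring
  have hcont : Continuous fun t : ℝ => 1 - t ^ 2 + t ^ 4 / 2 - t ^ 6 / 6 := by fun_prop
  have h1 : ∫ t in (0 : ℝ)..b, (1 - t ^ 2 + t ^ 4 / 2 - t ^ 6 / 6) =
      b - b ^ 3 / 3 + b ^ 5 / 10 - b ^ 7 / 42 := by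
    rw [intervalIntegral.integral_eq_sub_of_hasDerivAt (fun t _ => hF t) (hcont.intervalIntegrable _ _)]
    simp
  rw [← h1]
  exact intervalIntegral.integral_mono_on hb (hcont.intervalIntegrable _ _)
    (continuous_exp_neg_sq.intervalIntegrable _ _) fun t _ => by
      have := Literature.NumberTheory.LFunctions.ZetaRealLeRamare.cubic_le_exp_neg (sq_nonneg t)
      calc 1 - t ^ 2 + t ^ 4 / 2 - t ^ 6 / 6 = 1 - t ^ 2 + (t ^ 2) ^ 2 / 2 - (t ^ 2) ^ 3 / 6 := by ring
        _ ≤ Real.exp (-t ^ 2) := this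

/-- `∫₀^{6/5} e^{−t²} dt ≥ 0.7875` (the polynomial minorant at `6/5` is `0.78751…`; the true value is
`0.80675…`). [folklore] -/
theorem integral_exp_neg_sq_six_fifths : (0.7875 : ℝ) ≤ ∫ t in (0 : ℝ)..(6 / 5), Real.exp (-t ^ 2) := by
  refine le_trans ?_ (poly_le_integral_exp_neg_sq (by norm_num : (0 : ℝ) ≤ 6 / 5))
  norm_num

/-! ## §2 The sheet layer of a level: rate, slope, profile bounds -/

variable (R : TowerRates) (j : ℕ)

/-- The rate of the level-`j` sheet layer is positive: `κ_j = (3/5)^{1/2} N_j > 0`. [folklore] -/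
theorem rate_pos : 0 < burgersLayerRate (6 / 5 * R.N j ^ 2) 1 :=
  burgersLayerRate_pos (by have := R.N_pos j; positivity) one_pos

/-- `κ_j = (3/5)^{1/2} N_j`. [folklore] -/
theorem rate_eq : burgersLayerRate (6 / 5 * R.N j ^ 2) 1 = Real.sqrt (3 / 5) * R.N j :=
  OrthogonalSeed.burgersLayerRate_sheet (R.N_pos j).le

/-- `Y_j / N_j = N_j^{β−2}` (the level Reynolds number / circulation floor). [folklore] -/
theorem Y_div_N : R.Y j / R.N j = R.N j ^ (R.β - 2) := by
  have hN : 0 < R.N j := R.N_pos j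
  simp only [TowerRates.Y]
  rw [show R.β - 2 = R.β - 1 - 1 by ring, Real.rpow_sub_one hN.ne' (R.β - 1)]

/-! ## §3 The four faces, uniformly in `R` and `j` -/

/-- **Strain floor, every level, every rates**: `A_j ≤ ‖Du_j(0)‖` for the sheet layer `u_j` (the body of
`OrthogonalSeed.sheetBandUniform` for general `R`). [folklore] -/
theorem strainFloor :
    R.A j ≤ ‖fderiv ℝ (burgersLayer (6 / 5 * R.N j ^ 2) 1 (12 / 5 * R.Y j)) 0‖ := by
  have hN0 : 0 < R.N j := R.N_pos j
  have hY0 : 0 < R.Y j := Real.rpow_pos_of_pos hN0 _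
  have h := slope_le_norm_fderiv_burgersLayer (γ := 6 / 5 * R.N j ^ 2) (ν := 1) (ΔU := 12 / 5 * R.Y j)
    (x := (0 : EuclideanSpace ℝ (Fin 3))) rfl
  rw [rate_eq] at h
  refine le_trans ?_ h
  have hπs : 0 < Real.sqrt Real.pi := Real.sqrt_pos.2 Real.pi_pos
  rw [← OrthogonalSeed.Y_mul_N R j, show (12 : ℝ) / 5 * R.Y j / Real.sqrt Real.pi * (Real.sqrt (3 / 5) * R.N j) =
      (12 / 5 * Real.sqrt (3 / 5) / Real.sqrt Real.pi) * (R.Y j * R.N j) by ring]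
  have hc : (1 : ℝ) ≤ 12 / 5 * Real.sqrt (3 / 5) / Real.sqrt Real.pi := by
    rw [le_div_iff₀ hπs, one_mul]; exact OrthogonalSeed.sqrt_pi_le_sheet
  have hYN : 0 ≤ R.Y j * R.N j := by positivity
  nlinarith

/-- **Velocity floor, every level, every rates**: at `x⋆ = ((6/5)/κ_j, 0, 0)` the shear alone is
`V((6/5)/κ_j) ≥ (12/5)·0.7875/1.775·Y_j > Y_j`. [folklore] -/
theorem speedFloor :
    R.Y j ≤ ‖burgersLayer (6 / 5 * R.N j ^ 2) 1 (12 / 5 * R.Y j)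
      !₂[(6 / 5) / burgersLayerRate (6 / 5 * R.N j ^ 2) 1, 0, 0]‖ := by
  set κ := burgersLayerRate (6 / 5 * R.N j ^ 2) 1 with hκ
  have hκ0 : 0 < κ := rate_pos R j
  have hY0 : 0 ≤ R.Y j := (Real.rpow_pos_of_pos (R.N_pos j) _).le
  set x : EuclideanSpace ℝ (Fin 3) := !₂[(6 / 5) / κ, 0, 0] with hx
  have hx0 : x 0 = (6 / 5) / κ := by simp [hx]
  -- the shear component at `x⋆`
  have hV : (12 / 5 * R.Y j) / Real.sqrt Real.pi * 0.7875 ≤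
      burgersLayerProfile (6 / 5 * R.N j ^ 2) 1 (12 / 5 * R.Y j) (x 0) := by
    rw [hx0]
    unfold burgersLayerProfile
    rw [← hκ, show κ * (6 / 5 / κ) = 6 / 5 by field_simp]
    exact mul_le_mul_of_nonneg_left integral_exp_neg_sq_six_fifths (by positivity)
  have hπs : 0 < Real.sqrt Real.pi := Real.sqrt_pos.2 Real.pi_pos
  have hc1 : (1 : ℝ) ≤ 12 / 5 * 0.7875 / Real.sqrt Real.pi := by
    rw [le_div_iff₀ hπs]; nlinarith [OrthogonalSeed.sqrt_pi_le]
  have hc : R.Y j ≤ (12 / 5 * R.Y j) / Real.sqrt Real.pi * 0.7875 := by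
    have := mul_le_mul_of_nonneg_left hc1 hY0
    calc R.Y j = R.Y j * 1 := (mul_one _).symm
      _ ≤ R.Y j * (12 / 5 * 0.7875 / Real.sqrt Real.pi) := this
      _ = (12 / 5 * R.Y j) / Real.sqrt Real.pi * 0.7875 := by ring
  calc R.Y j ≤ burgersLayerProfile (6 / 5 * R.N j ^ 2) 1 (12 / 5 * R.Y j) (x 0) := hc.trans hV
    _ = burgersLayer (6 / 5 * R.N j ^ 2) 1 (12 / 5 * R.Y j) x 1 := (burgersLayer_apply_one _ _ _ x).symm
    _ ≤ |burgersLayer (6 / 5 * R.N j ^ 2) 1 (12 / 5 * R.Y j) x 1| := le_abs_self _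
    _ = ‖burgersLayer (6 / 5 * R.N j ^ 2) 1 (12 / 5 * R.Y j) x 1‖ := (Real.norm_eq_abs _).symm
    _ ≤ ‖burgersLayer (6 / 5 * R.N j ^ 2) 1 (12 / 5 * R.Y j) x‖ := PiLp.norm_apply_le _ _

/-- The read-out point `x⋆` lies within `2/N_j` of the origin (`(6/5)/κ_j = (6/5)(5/3)^{1/2}/N_j ≤ 1.6/N_j`).
[folklore] -/
theorem norm_point_le :
    ‖(!₂[(6 / 5) / burgersLayerRate (6 / 5 * R.N j ^ 2) 1, 0, 0] : EuclideanSpace ℝ (Fin 3))‖ ≤ 2 / R.N j := by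
  have hN : 0 < R.N j := R.N_pos j
  have hκ0 : 0 < burgersLayerRate (6 / 5 * R.N j ^ 2) 1 := rate_pos R j
  have hs : (3 : ℝ) / 4 ≤ Real.sqrt (3 / 5) := by
    rw [show (3 : ℝ) / 4 = Real.sqrt ((3 / 4) ^ 2) by rw [Real.sqrt_sq (by norm_num)]]
    exact Real.sqrt_le_sqrt (by norm_num)
  have hval : ‖(!₂[(6 / 5) / burgersLayerRate (6 / 5 * R.N j ^ 2) 1, 0, 0] : EuclideanSpace ℝ (Fin 3))‖ =
      (6 / 5) / burgersLayerRate (6 / 5 * R.N j ^ 2) 1 := by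
    have hsq := norm_vec3_sq ((6 / 5) / burgersLayerRate (6 / 5 * R.N j ^ 2) 1) 0 0
    exact (sq_eq_sq₀ (norm_nonneg _) (by positivity)).1 (by rw [hsq]; ring)
  rw [hval, rate_eq, div_le_div_iff₀ (by positivity) hN]
  nlinarith

/-- **Slab ceiling, every level, every rates**: `‖u_j(x)‖ ≤ (5/3)Y_j` on the slab
`N_j⁴(x₀² + x₂²) ≤ (9/10)Y_j²`. [folklore] -/
theorem slabCeiling (x : EuclideanSpace ℝ (Fin 3)) (hx : R.N j ^ 4 * (x 0 ^ 2 + x 2 ^ 2) ≤ 9 / 10 * R.Y j ^ 2) :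
    ‖burgersLayer (6 / 5 * R.N j ^ 2) 1 (12 / 5 * R.Y j) x‖ ≤ 5 / 3 * R.Y j := by
  have hN : 0 < R.N j := R.N_pos j
  have hY0 : 0 ≤ R.Y j := (Real.rpow_pos_of_pos hN _).le
  have hV := burgersLayerProfile_sq_le (γ := 6 / 5 * R.N j ^ 2) (ν := 1) (ΔU := 12 / 5 * R.Y j)
    (by positivity) one_pos (by positivity) (x 0)
  have hsq := norm_burgersLayer_sq (6 / 5 * R.N j ^ 2) 1 (12 / 5 * R.Y j) x
  have h1 : ‖burgersLayer (6 / 5 * R.N j ^ 2) 1 (12 / 5 * R.Y j) x‖ ^ 2 ≤ (5 / 3 * R.Y j) ^ 2 := by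
    rw [hsq]
    nlinarith [hx, hV]
  nlinarith [norm_nonneg (burgersLayer (6 / 5 * R.N j ^ 2) 1 (12 / 5 * R.Y j) x), h1, hY0]

/-- **Core-ledger floor, every level, every rates**: on the horizontal circle of radius `1/N_j` the sheet
layer carries circulation `≥ (48/25)√π(3/5)^{1/2} · N_j^{β−2} ≥ N_j^{β−2}` (`circulation_circle_ge` with
`κρ = (3/5)^{1/2}`, and `Y_j/N_j = N_j^{β−2}`). [folklore] -/
theorem coreFloor :
    R.N j ^ (R.β - 2) ≤ circulation (burgersLayer (6 / 5 * R.N j ^ 2) 1 (12 / 5 * R.Y j))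
      (fun s : ℝ => (!₂[(1 / R.N j) * Real.cos (2 * π * s), (1 / R.N j) * Real.sin (2 * π * s), 0] :
        EuclideanSpace ℝ (Fin 3))) := by
  have hN : 0 < R.N j := R.N_pos j
  have hY0 : 0 ≤ R.Y j := (Real.rpow_pos_of_pos hN _).le
  have h := circulation_circle_ge (γ := 6 / 5 * R.N j ^ 2) (ν := 1) (ΔU := 12 / 5 * R.Y j)
    (by positivity) one_pos (by positivity) (1 / R.N j)
  refine le_trans ?_ h
  rw [rate_eq, ← Y_div_N]
  -- `κρ = √(3/5)`, `κ²ρ² = 3/5`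
  have hs : Real.sqrt (3 / 5) ^ 2 = 3 / 5 := Real.sq_sqrt (by norm_num)
  have hkr : (Real.sqrt (3 / 5) * R.N j) ^ 2 * (1 / R.N j) ^ 2 = 3 / 5 := by
    rw [mul_pow, hs]; field_simp
  rw [hkr]
  have hπs : 0 < Real.sqrt Real.pi := Real.sqrt_pos.2 Real.pi_pos
  have hsq3 : (3 : ℝ) / 4 ≤ Real.sqrt (3 / 5) := by
    rw [show (3 : ℝ) / 4 = Real.sqrt ((3 / 4) ^ 2) by rw [Real.sqrt_sq (by norm_num)]]
    exact Real.sqrt_le_sqrt (by norm_num)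
  have hsqπ : (1.7 : ℝ) ≤ Real.sqrt Real.pi := by
    rw [show (1.7 : ℝ) = Real.sqrt (1.7 ^ 2) by rw [Real.sqrt_sq (by norm_num)]]
    exact Real.sqrt_le_sqrt (by linarith [Real.pi_gt_three])
  have hππ : π / Real.sqrt Real.pi = Real.sqrt Real.pi := Real.div_sqrt
  -- the bound equals `(48/25) (π/√π) √(3/5) · (Y/N)`
  have hrw : π * (12 / 5 * R.Y j / Real.sqrt Real.pi * (Real.sqrt (3 / 5) * R.N j * (1 / R.N j) ^ 2 *
      (1 - 3 / 5 / 3))) = (48 / 25 * (π / Real.sqrt Real.pi) * Real.sqrt (3 / 5)) * (R.Y j / R.N j) := by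
    field_simp
    ring
  rw [hrw, hππ]
  have hc : (1 : ℝ) ≤ 48 / 25 * Real.sqrt Real.pi * Real.sqrt (3 / 5) := by nlinarith
  have hYN : 0 ≤ R.Y j / R.N j := by positivity
  nlinarith

/-! ## §4 The register's clauses, every level (rigid schedules on the rates `R`) -/

variable {R}

/-- **Floor clause at level `j`** (`Stage.floor`, slice replaced by the sheet layer): needs the ball radius
`≥ 2/N_j`. [folklore] -/
theorem floor_clause (S : Schedule R) (hS : S.Rigid) (hr : 2 / R.N j ≤ S.radius) :
    ∃ x : EuclideanSpace ℝ (Fin 3), ‖x‖ ≤ S.radius ∧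
      S.c₁ * R.Y j ≤ ‖burgersLayer (6 / 5 * R.N j ^ 2) 1 (12 / 5 * R.Y j) x‖ :=
  ⟨_, (norm_point_le R j).trans hr, by rw [hS.c₁_eq, one_mul]; exact speedFloor R j⟩

/-- **Strain clause at level `j`** (`Margins.withStrain`, slice replaced by the sheet layer). [folklore] -/
theorem strain_clause (S : Schedule R) (hS : S.Rigid) (hr : 0 ≤ S.radius) :
    ∃ x : EuclideanSpace ℝ (Fin 3), ‖x‖ ≤ S.radius ∧
      S.c₁ * R.A j ≤ ‖fderiv ℝ (burgersLayer (6 / 5 * R.N j ^ 2) 1 (12 / 5 * R.Y j)) x‖ :=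
  ⟨0, by rwa [norm_zero], by rw [hS.c₁_eq, one_mul]; exact strainFloor R j⟩

/-- **Ceiling clause at level `j` on the slab** (`Stage.ceiling`, slice replaced by the sheet layer). [folklore] -/
theorem ceiling_clause (S : Schedule R) (hS : S.Rigid) (x : EuclideanSpace ℝ (Fin 3))
    (hx : R.N j ^ 4 * (x 0 ^ 2 + x 2 ^ 2) ≤ 9 / 10 * R.Y j ^ 2) :
    ‖burgersLayer (6 / 5 * R.N j ^ 2) 1 (12 / 5 * R.Y j) x‖ ≤ S.c₂ * R.Y j := by
  rw [hS.c₂_eq]; exact slabCeiling R j x hx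

/-- **Core-ledger clause at level `j`** (the `j`-clause of `CoreLedger R S k u`, slice replaced by the sheet
layer): the circle of radius `1/N_j` about the origin is admissible (`C¹`, closed, inside the closed ball,
speed `2π/N_j ≤ 8π/N_j`) and carries circulation `≥ c₁ N_j^{β−2}`. [folklore] -/
theorem coreLedger_clause (S : Schedule R) (hS : S.Rigid) (hr : 0 ≤ S.radius) :
    ∃ (x : EuclideanSpace ℝ (Fin 3)) (γ : ℝ → EuclideanSpace ℝ (Fin 3)),
      ‖x‖ ≤ S.radius ∧ ContDiff ℝ 1 γ ∧ γ 0 = γ 1 ∧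
      (∀ s ∈ Icc (0 : ℝ) 1, γ s ∈ Metric.closedBall x (1 / R.N j)) ∧
      (∀ s ∈ Icc (0 : ℝ) 1, ‖deriv γ s‖ ≤ 8 * π / R.N j) ∧
      S.c₁ * R.N j ^ (R.β - 2) ≤
        circulation (burgersLayer (6 / 5 * R.N j ^ 2) 1 (12 / 5 * R.Y j)) γ := by
  have hρ : 0 ≤ 1 / R.N j := (one_div_pos.2 (R.N_pos j)).le
  refine ⟨0, fun s : ℝ => (!₂[(1 / R.N j) * Real.cos (2 * π * s), (1 / R.N j) * Real.sin (2 * π * s), 0] :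
      EuclideanSpace ℝ (Fin 3)), by rwa [norm_zero], contDiff_circle _, circle_closed _,
    fun s _ => circle_mem_closedBall hρ s, fun s _ => ?_, by rw [hS.c₁_eq, one_mul]; exact coreFloor R j⟩
  have := norm_deriv_circle_le hρ s
  rw [show 8 * π * (1 / R.N j) = 8 * π / R.N j by ring] at this
  exact this

/-- **The sheet read-out is `j`-UNIFORM on the wide rates** (the four faces of `LayerReadoutWide`'s shape,
for every level `j`). [folklore] -/
theorem uniform (j : ℕ) :
    TowerRates.wide.Y j ≤ ‖burgersLayer (6 / 5 * TowerRates.wide.N j ^ 2) 1 (12 / 5 * TowerRates.wide.Y j)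
        !₂[(6 / 5) / burgersLayerRate (6 / 5 * TowerRates.wide.N j ^ 2) 1, 0, 0]‖ ∧
    TowerRates.wide.A j ≤
      ‖fderiv ℝ (burgersLayer (6 / 5 * TowerRates.wide.N j ^ 2) 1 (12 / 5 * TowerRates.wide.Y j)) 0‖ ∧
    (∀ x : EuclideanSpace ℝ (Fin 3),
      TowerRates.wide.N j ^ 4 * (x 0 ^ 2 + x 2 ^ 2) ≤ 9 / 10 * TowerRates.wide.Y j ^ 2 →
        ‖burgersLayer (6 / 5 * TowerRates.wide.N j ^ 2) 1 (12 / 5 * TowerRates.wide.Y j) x‖ ≤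
          5 / 3 * TowerRates.wide.Y j) ∧
    TowerRates.wide.N j ^ (TowerRates.wide.β - 2) ≤
      circulation (burgersLayer (6 / 5 * TowerRates.wide.N j ^ 2) 1 (12 / 5 * TowerRates.wide.Y j))
        (fun s : ℝ => (!₂[(1 / TowerRates.wide.N j) * Real.cos (2 * π * s),
          (1 / TowerRates.wide.N j) * Real.sin (2 * π * s), 0] : EuclideanSpace ℝ (Fin 3))) :=
  ⟨speedFloor TowerRates.wide j, strainFloor TowerRates.wide j, slabCeiling TowerRates.wide j,
    coreFloor TowerRates.wide j⟩

end SheetReadout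

end Summit.NavierStokesRegularity.FluidComputer.PalasekTowerClayBridge

end
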